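import Literature.AlgebraicGeometry.DuqueFrancoVillaflor2025.JoinArtinianGorenstein
import Literature.AlgebraicGeometry.HodgeTheory.FermatJacobianRingGorenstein
import HarnessLib

/-!
# Joins of cycles in the Fermat variety: `(J^F : P(x)·Q(y)) = (J^{F₁} : P)·S + (J^{F₂} : Q)·S`

J. Duque Franco, R. Villaflor Loyola, *Periods of join algebraic cycles*, Ann. Sc. Norm. Super. Pisa Cl. Sci.
(2025) = arXiv:2312.17222 [DuqueFrancoVillaflor2025Join], Theorem 1.1 (second part) and its use in §6–7 for the
Fermat variety `X^n_d = {x_0^d + ⋯ + x_{n+1}^d = 0}`, which is the join ("Thom–Sebastiani sum") of the Fermat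
varieties in any two complementary groups of its variables, `F = F₁(x) + F₂(y)`:

> **Theorem 1.1.** […] `R^{f+g,δ} = R^{f,[Z₁]} ⊗ R^{g,[Z₂]} ⟺ δ = c·[J(Z₁,Z₂)]_prim` […]
> (proof, p. 11) `J^{f+g,δ} ⊆ (J^{f+g}, P_{Z₁}·P_{Z₂}) = J^{f+g,[J(Z₁,Z₂)]}`. Since both are Artinian Gorenstein
> ideals of socle in degree `(d−2)(n/2+1)`, they are equal.
>
> **Remark 7.1.** […] `J^{F,λ} = ⟨x_0 − c_0x_1, …, x_n − c_{n/2}x_{n+1}, x_0^{d−1}, …, x_{n+1}^{d−1}⟩` […];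
> **Remark 7.2.** […] for any algebraic cycle given as a cone `Z = J(pt, Z₂)` […]

**What this file proves** (any field `K`, finite index types `σ`, `τ`, exponent `e = d − 1 ≥ 1`; the monomial
complete intersection `J_ι := (x_i^e : i ∈ ι)` is the Jacobian ideal of the Fermat polynomial `Σ x_i^{e+1}` up
to the unit `e+1`, tree `jacobianIdeal_fermatPolynomial`):
* `span_X_pow_sum_eq`: `J_{σ ⊔ τ} = J_σ·S + J_τ·S` in `S = K[x_σ ⊔ y_τ]` ("`J^{f+g} = J^f + J^g`" for `F = F₁(x) + F₂(y)`);
* **`span_X_pow_colon_rename_mul`**: for ALL `P ∈ K[x_σ]`, `Q ∈ K[y_τ]`,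
  `(J_{σ⊔τ} : P(x)·Q(y)) = (J_σ : P)·S + (J_τ : Q)·S` — Theorem 1.1's `J^{F,[J(Z₁,Z₂)]} = J^{F₁,[Z₁]}·S + J^{F₂,[Z₂]}·S`
  at the Fermat point, granted the transcendental input `P_{J(Z₁,Z₂)} = P_{Z₁}·P_{Z₂}` (NOT formalised), via the
  tree's `IsArtinianGorenstein.colon_join` and Macaulay's theorem at the Fermat point
  (`isArtinianGorenstein_span_X_pow`);
* `isArtinianGorenstein_span_X_pow_colon_rename_mul`: its socle is `s₁ + s₂` for `deg P = |σ|(e−1) − s₁`,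
  `deg Q = |τ|(e−1) − s₂`, `P ∉ J_σ`, `Q ∉ J_τ` (Def. 2.2's `(d−2)(k/2+1) + (d−2)((n−k)/2) = (d−2)(n/2+1)`);
* the Hilbert-function consequences (Cor. 6.1 at the Fermat point, Ex. 6.1, Rem. 7.2 cones) are in the
  companion file `HodgeTheory/FermatJoinHilbertFunction.lean`.
This is the algebra behind every join / cone row of the Hodge-locus census at the Fermat point (linear cycles
`= J(pt,…,pt)`, Rem. 7.1; cones `J(pt, Z₂)`, Rem. 7.2). HONEST FRAMING (cell pub-hlocus): certified instances and
evidence bearing on the general Hodge conjecture; no claim.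
-/

noncomputable section

open MvPolynomial Module Literature.RingTheory.MvPolynomial Literature.AlgebraicGeometry.Kloosterman2025
  Literature.AlgebraicGeometry.DuqueFrancoVillaflor2025

namespace Literature.AlgebraicGeometry.HodgeTheory

variable {K : Type*} [Field K] {σ τ : Type*} {e : ℕ}

/-- **`J^{F₁+F₂} = J^{F₁}·S + J^{F₂}·S`** for the monomial complete intersections: `(x_k^e : k ∈ σ ⊔ τ)` is
generated by the images of `(x_i^e : i ∈ σ)` and `(y_j^e : j ∈ τ)`. [cite: DuqueFrancoVillaflor2025Join, Theorem 1.1 (proof)] -/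
theorem span_X_pow_sum_eq (e : ℕ) :
    Ideal.span (Set.range fun k : σ ⊕ τ => (X k : MvPolynomial (σ ⊕ τ) K) ^ e) =
      (Ideal.span (Set.range fun i : σ => (X i : MvPolynomial σ K) ^ e)).map (rename Sum.inl) ⊔
        (Ideal.span (Set.range fun j : τ => (X j : MvPolynomial τ K) ^ e)).map (rename Sum.inr) := by
  have hfun : (fun k : σ ⊕ τ => (X k : MvPolynomial (σ ⊕ τ) K) ^ e) =
      Sum.elim (⇑(rename (R := K) (Sum.inl : σ → σ ⊕ τ)) ∘ fun i : σ => (X i : MvPolynomial σ K) ^ e)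
        (⇑(rename (R := K) (Sum.inr : τ → σ ⊕ τ)) ∘ fun j : τ => (X j : MvPolynomial τ K) ^ e) := by
    funext k
    rcases k with i | j <;> simp [rename_X]
  rw [Ideal.map_span, Ideal.map_span, ← Ideal.span_union, ← Set.range_comp, ← Set.range_comp,
    ← Set.Sum.elim_range, hfun]

/-- **Theorem 1.1 at the Fermat point**: for `e ≥ 1` and ALL `P ∈ K[x_σ]`, `Q ∈ K[y_τ]`,
`((x_k^e : k ∈ σ ⊔ τ) : P(x)Q(y)) = ((x_i^e) : P)·S + ((y_j^e) : Q)·S` — i.e.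
`J^{F,[J(Z₁,Z₂)]} = (J^F : P_{Z₁}P_{Z₂}) = J^{F₁,[Z₁]}·S + J^{F₂,[Z₂]}·S`,
`R^{F,[J(Z₁,Z₂)]} = R^{F₁,[Z₁]} ⊗ R^{F₂,[Z₂]}` for the Fermat polynomial `F = F₁(x) + F₂(y)` (granted
`P_{J(Z₁,Z₂)} = P_{Z₁}·P_{Z₂}`). [cite: DuqueFrancoVillaflor2025Join, Theorem 1.1] -/
theorem span_X_pow_colon_rename_mul [Fintype σ] [Fintype τ] (he : 1 ≤ e) (P : MvPolynomial σ K)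
    (Q : MvPolynomial τ K) :
    (Ideal.span (Set.range fun k : σ ⊕ τ => (X k : MvPolynomial (σ ⊕ τ) K) ^ e)).colon
        {rename Sum.inl P * rename Sum.inr Q} =
      ((Ideal.span (Set.range fun i : σ => (X i : MvPolynomial σ K) ^ e)).colon {P}).map (rename Sum.inl) ⊔
        ((Ideal.span (Set.range fun j : τ => (X j : MvPolynomial τ K) ^ e)).colon {Q}).map (rename Sum.inr) := by
  rw [span_X_pow_sum_eq]
  exact (isArtinianGorenstein_span_X_pow (K := K) (ι := σ) he).colon_join
    (isArtinianGorenstein_span_X_pow (K := K) (ι := τ) he) P Q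

/-- … in the functional presentation of the tree (`(J : P) = Ann(coeff_{β₀}(· P))`):
`Ann(ℓ_σ(·P) ⊗ ℓ_τ(·Q)) = (J_σ : P)·S + (J_τ : Q)·S`, where `ℓ_ι = coeff of ∏ x_i^{e−1}` is the socle functional.
[cite: DuqueFrancoVillaflor2025Join, Theorem 1.1] [cite: IarrobinoKanev1999, Example 5.8] -/
theorem span_X_pow_colon_rename_mul_eq_annIdeal [Fintype σ] [Fintype τ] (he : 1 ≤ e) (P : MvPolynomial σ K)
    (Q : MvPolynomial τ K) :
    (Ideal.span (Set.range fun k : σ ⊕ τ => (X k : MvPolynomial (σ ⊕ τ) K) ^ e)).colon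
        {rename Sum.inl P * rename Sum.inr Q} =
      annIdeal (tensorFunctional (fermatSocleFunctional K σ e ∘ₗ LinearMap.mulRight K P)
        (fermatSocleFunctional K τ e ∘ₗ LinearMap.mulRight K Q)) := by
  haveI := finiteDimensional_quotient_annIdeal
    (fermatSocleFunctional_homogeneousComponent (K := K) (ι := τ) (e := e))
  symm
  rw [← tensorFunctional_comp_mulRight, annIdeal_comp_mulRight, annIdeal_tensorFunctional,
    annIdeal_fermatSocleFunctional he, annIdeal_fermatSocleFunctional he, ← span_X_pow_sum_eq]

/-- **Socle bookkeeping (Def. 2.2 for a join)**: if `P ∉ (x_i^e)` is a form of degree `e₁` with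
`e₁ + s₁ = |σ|(e−1)` and `Q ∉ (y_j^e)` a form of degree `e₂` with `e₂ + s₂ = |τ|(e−1)`, then
`((x_k^e : k ∈ σ ⊔ τ) : P(x)Q(y))` is Artinian Gorenstein of socle `s₁ + s₂` — for half-dimensional cycles
`(d−2)(k/2+1) + (d−2)((n−k)/2) = (d−2)(n/2+1) = ½ soc(J^F)`. [cite: DuqueFrancoVillaflor2025Join, Theorem 1.1]
[cite: DuqueFrancoVillaflor2025Join, Definition 2.2] -/
theorem isArtinianGorenstein_span_X_pow_colon_rename_mul [Fintype σ] [Fintype τ] (he : 1 ≤ e)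
    {P : MvPolynomial σ K} {Q : MvPolynomial τ K} {e₁ s₁ e₂ s₂ : ℕ} (hP : P.IsHomogeneous e₁)
    (hes₁ : e₁ + s₁ = Fintype.card σ * (e - 1))
    (hPJ : P ∉ Ideal.span (Set.range fun i : σ => (X i : MvPolynomial σ K) ^ e))
    (hQ : Q.IsHomogeneous e₂) (hes₂ : e₂ + s₂ = Fintype.card τ * (e - 1))
    (hQJ : Q ∉ Ideal.span (Set.range fun j : τ => (X j : MvPolynomial τ K) ^ e)) :
    IsArtinianGorenstein ((Ideal.span (Set.range fun k : σ ⊕ τ => (X k : MvPolynomial (σ ⊕ τ) K) ^ e)).colon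
      {rename Sum.inl P * rename Sum.inr Q}) (s₁ + s₂) := by
  rw [span_X_pow_sum_eq]
  exact (isArtinianGorenstein_span_X_pow (K := K) (ι := σ) he).colon_join_isArtinianGorenstein
    (isArtinianGorenstein_span_X_pow (K := K) (ι := τ) he) hP hes₁ hPJ hQ hes₂ hQJ

/-- The product `P(x)·Q(y)` stays outside `J_{σ⊔τ}` when `P ∉ J_σ` and `Q ∉ J_τ` (so the join class is
non-trivial: `(J : PQ) ≠ S`). [cite: DuqueFrancoVillaflor2025Join, Theorem 1.1] -/
theorem rename_mul_rename_notMem_span_X_pow [Fintype σ] [Fintype τ] (he : 1 ≤ e)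
    {P : MvPolynomial σ K} {Q : MvPolynomial τ K}
    (hPJ : P ∉ Ideal.span (Set.range fun i : σ => (X i : MvPolynomial σ K) ^ e))
    (hQJ : Q ∉ Ideal.span (Set.range fun j : τ => (X j : MvPolynomial τ K) ^ e)) :
    rename Sum.inl P * rename Sum.inr Q ∉
      Ideal.span (Set.range fun k : σ ⊕ τ => (X k : MvPolynomial (σ ⊕ τ) K) ^ e) := by
  intro hmem
  have htop : (Ideal.span (Set.range fun k : σ ⊕ τ => (X k : MvPolynomial (σ ⊕ τ) K) ^ e)).colon
      {rename Sum.inl P * rename Sum.inr Q} = ⊤ := IsArtinianGorenstein.colon_eq_top_of_mem hmem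
  rw [span_X_pow_colon_rename_mul_eq_annIdeal he, annIdeal_eq_top_iff] at htop
  refine tensorFunctional_ne_zero ?_ ?_ htop
  · intro h0
    apply hPJ
    rw [← annIdeal_fermatSocleFunctional he, ← annIdeal_comp_mulRight_eq_top_iff, annIdeal_eq_top_iff]
    exact h0
  · intro h0
    apply hQJ
    rw [← annIdeal_fermatSocleFunctional he, ← annIdeal_comp_mulRight_eq_top_iff, annIdeal_eq_top_iff]
    exact h0

end Literature.AlgebraicGeometry.HodgeTheory

end
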